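import Summits.QuantumFields.YangMills.Theorems.BalabanUVNodesK0S5CollarCubeDomains
import HarnessLib

/-!
# BalabanUVNodes ∕ N07 — S6, THE NEAR-DATA JUNCTION: **print's (160) «|B(x,x′)| < (8d²L² + 4L²|x − y|)ε₁», a bound growing with the distance from the CENTRE `y` of
# the window, FEEDS the per-bond near hypothesis `‖B c‖ ≤ C_d·M_Δ·ε₁·(distBI(b,c) + 1)` of the S5 → S6 socket (`letters10On_HB_of_core_adm22_T4` ∕ `…_cubeDomains_box`)
# with `M_Δ := M` = the side of the window `□ = box L a M k`** — for EVERY nested family `D` of height `k` and every window box: at a top-level cell the (161)-distance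
# `distBI(b, c)` from a bond `b` of `π(□)` controls the distance of `c₋` from the centre up to the block-diameter `M − 1` of `□` (triangle inequality on `T^{(k)}`)

Cell `pub-ymgap`, width seat `pub-ymgap-dag-n07-w4` gen 2 (director-ym №197 ∕ HUMAN RULING D-0149), node N07 = [15] = [Balaban1985Variational] (CMP **102** (1985) 277–309);
sub-target S6 (the junction of the data lane's (160) — n07-e g18's BRIDGE-92 — to this seat's `HB`-summand theorems).  `--kind proof --supports stmt-QuantumFields-20542 --as helper`;
count-neutral; def-free.  CONSUMED BY NAME, nothing restated: ym3-torus `FlatCubeOpsText.distBI`, n07-e module 38 `Node00.coverAt ∕ iterBlockOf_cover`, k0-s1-w3 g3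
`K0S5CollarCubeDomains.blockMap_box_bounds`, pub-balaban `B5Prop12FieldsLattice.distSite` (+ `distSite_comm ∕ distSite_triangle ∕ distSite_nonneg`), n05-a `B8Eq131Cubes.box`.
(The d = 3 ∕ `cubeSeqMT3` twin is ym3-torus's `HalvingDatum160` §4 `dist_le_distBI_add` ∕ `hnear_of_topFamily`; here generic `P`, ANY `D`, the door-(a) window `π '' box`.)

WHY.  Print p. 303: *«|V₁′(x,x′) − 1| < |x − y|2L²ε₁ for ⟨x,x′⟩ ⊂ □^{(k)} … Finally we have |B(x,x′)| < (8d²L² + 4L²|x − y|)ε₁ for ⟨x,x′⟩ ∈ □′_k^{(k−1)} ∪ □″_k^{(k)} (160)»*, `y` the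
centre of the axial gauge on `□`, and (161)–(162) turn the growth `|x − y|` into the factor `M_Δ` («M_Δ = 1 for Δ = Δ₀, M_Δ = M for Δ = □»).  The tree's socket asks the near
size PER EVALUATION BOND `b`: `‖B c‖ ≤ C_d·M_Δ·ε₁·(distBI D b c + 1)`.  THIS FILE is the conversion: for `b₋, π x_c ∈ π(□)` and a top-level cell `c`,
`dist_k(c₋, Bᵏ(π x_c)) ≤ distBI(b, c) + (M − 1)`, hence a centred bound `β·(dist_k(c₋, Bᵏy) + 1)` gives the per-bond bound `β·M·(distBI(b,c) + 1)`.

CONTENTS (generic `P : Params`).  §1 `natAbs_valMinAbs_intCast_sub_le` · `distSite_coverAt_le` (torus distance of two level-`n` covers ≤ the sup of the label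
differences) · ★ `distSite_iterBlockOf_cover_le_of_mem_box` (two points of `□ = box L a M k` have `k`-blocks at torus distance `≤ M − 1`).  §2 ★ `dist_le_distBI_add_top`
(ANY `D`: at a top-level cell, `dist_k(c₋, Bᵏx₀) ≤ distBI D b c + r₀` whenever `dist_k(Bᵏb₋, Bᵏx₀) ≤ r₀`).  §3 ★★★ `near_of_centred_box` (centred (160)-shape bound ⇒ the
socket's per-bond near hypothesis on `π '' box` with `M_Δ := M`).

HONEST FRAMING: count-neutral lattice bookkeeping; (160) itself (the data identity + the (7)-smallness at the record = BRIDGE-92) is NOT proved here — it is the HYPOTHESIS `hX`;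
nothing of [15] asserted; tokens NOT discharged; stub 1 ∕ K0⁷ ∕ K1⁷ NOT closed; N07 NOT discharged; counts unmoved (typed 28∕28 · discharged 5∕27); one finite 𝕋⁴ programme at
fixed ε — R4 closes the conditional finite-𝕋⁴ rung `BalabanLadder.UV` ONLY; the YM mass gap (Clay) is NOT proved by any of this; nothing continuum ∕ ℝ⁴ ∕ OS.  No `def`, no
`instance`, no `notation`, no `sorry`.
-/

set_option autoImplicit false

noncomputable section

namespace Summit.QuantumFields.YangMills.BalabanUVNodes.N07NearDataOfCentre

open Literature.MathematicalPhysics.QuantumFieldTheory.Balaban1983to89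
open Literature.MathematicalPhysics.QuantumFieldTheory.Balaban1983to89.Node00 (coverAt coverAt_apply iterBlockOf_cover)
open Literature.MathematicalPhysics.QuantumLattice (blockMap)
open B15Eq112TorusCover (cover)
open B14DomainGeom (Pt)
open B5Eq117TorusCarriers (Mk)
open B5Eq118OneStroke (iterBlockOf)
open B5Prop12FieldsLattice (distSite distSite_nonneg)
open B5RowSumsP12Lattice (distSite_comm distSite_triangle)
open B6SectADomainsV1 (Domains)
open B6SectAOperatorsV1 (BondIdx)
open B8Eq131Cubes (box)
open Summit.QuantumFields.YangMills.Theorems.FlatCubeOpsText (distBI)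
open Summit.QuantumFields.YangMills.Theorems.K0S5CollarCubeDomains (blockMap_box_bounds)

variable {P : Params}

/-! ## §1  Torus distance of covers is at most the label distance; the window's `k`-blocks are within `M − 1` of each other -/

/-- The minimal residue of an integer is at most the integer: `|((z : ℤ) mod N)_min| ≤ |z|`. [folklore] -/
theorem natAbs_valMinAbs_intCast_le {N : ℕ} [NeZero N] (z : ℤ) : (((z : ZMod N)).valMinAbs).natAbs ≤ z.natAbs :=
  ZMod.natAbs_min_of_le_div_two N _ z (ZMod.coe_valMinAbs _) (ZMod.natAbs_valMinAbs_le _)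

/-- **TORUS DISTANCE OF TWO COVERS ≤ THE SUP LABEL DIFFERENCE**: if `|u_μ − v_μ| ≤ W` for all `μ` then `dist_n(π_n u, π_n v) ≤ W`. [cite: Balaban1987RG1, (0.1) p.251 (bookkeeping)] -/
theorem distSite_coverAt_le (n : ℕ) {u v : Pt P.d} {W : ℕ} (h : ∀ μ, (u μ - v μ).natAbs ≤ W) :
    distSite (Mk P n) (coverAt P n u) (coverAt P n v) ≤ (W : ℝ) := by
  unfold distSite
  have key : (Finset.univ.sup fun μ : Fin P.d => ((coverAt P n u μ - coverAt P n v μ).valMinAbs).natAbs) ≤ W := by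
    refine Finset.sup_le fun μ _ => ?_
    have hc : coverAt P n u μ - coverAt P n v μ = ((u μ - v μ : ℤ) : ZMod (P.sitesPerDir n)) := by
      rw [coverAt_apply, coverAt_apply, Int.cast_sub]
    rw [hc]
    exact (natAbs_valMinAbs_intCast_le _).trans (h μ)
  exact_mod_cast key

/-- ★ **THE `k`-BLOCKS OF TWO POINTS OF THE WINDOW `□ = box L a M k` ARE WITHIN `M − 1` ON `T^{(k)}`** (`k ≤ m + K`, `1 ≤ M`): their level-`k` labels both lie in `[a, a + M − 1]`
(`blockMap_box_bounds` at depth `0`), and the torus distance of the covers is at most the label difference. [cite: Balaban1985RegularSpaces, p.98 («we take a size of □ equal to MLʲη»); Balaban1985Variational, (161) p.303 («M_Δ = M for Δ = □»)] -/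
theorem distSite_iterBlockOf_cover_le_of_mem_box {a : Pt P.d} {M k : ℕ} (hk : k ≤ P.m + P.K) (hM : 1 ≤ M) {x x' : Pt P.d}
    (hx : x ∈ box P.L a M k) (hx' : x' ∈ box P.L a M k) :
    distSite (Mk P k) (iterBlockOf k (cover P x)) (iterBlockOf k (cover P x')) ≤ ((M - 1 : ℕ) : ℝ) := by
  rw [iterBlockOf_cover hk, iterBlockOf_cover hk]
  refine distSite_coverAt_le k fun μ => ?_
  have h1 := blockMap_box_bounds (le_refl k) hx μ
  have h2 := blockMap_box_bounds (le_refl k) hx' μ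
  simp only [Nat.sub_self, pow_zero, one_mul] at h1 h2
  have hM' : ((M - 1 : ℕ) : ℤ) = (M : ℤ) - 1 := by omega
  omega

/-! ## §2  At a top-level cell the (161)-distance from a bond controls the distance from any centre block -/

/-- ★ **`dist_k(c₋, Bᵏx₀) ≤ distBI(b, c) + r₀` AT A TOP-LEVEL CELL** of ANY nested family `D` (`j(c) = D.k`), for every fine bond `b` whose `k`-block is within `r₀` of `Bᵏx₀`:
`distBI D b c = dist_k(Bᵏb₋, c₋)` there (normalising power `L⁰`), and the triangle inequality on `T^{(k)}`. [cite: Balaban1985Variational, (161) p.303] -/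
theorem dist_le_distBI_add_top (D : Domains P) (c : BondIdx D) (hc : (c.1.1 : ℕ) = D.k) {b : PBond P 0} {x₀ : Site P 0} {r₀ : ℝ}
    (hb : distSite (Mk P D.k) (iterBlockOf D.k b.src) (iterBlockOf D.k x₀) ≤ r₀) :
    distSite (Mk P (c.1.1 : ℕ)) c.1.2.src (iterBlockOf (c.1.1 : ℕ) x₀) ≤ distBI D b c + r₀ := by
  obtain ⟨⟨j, e⟩, hlam⟩ := c
  change (j : ℕ) = D.k at hc
  unfold distBI
  simp only
  have hk0 : D.k - (j : ℕ) = 0 := by omega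
  rw [hk0, pow_zero, one_mul]
  rw [← hc] at hb
  have htri := distSite_triangle (Mk P (j : ℕ)) e.src (iterBlockOf (j : ℕ) b.src) (iterBlockOf (j : ℕ) x₀)
  rw [distSite_comm (Mk P (j : ℕ)) e.src (iterBlockOf (j : ℕ) b.src)] at htri
  linarith

/-! ## §3  ★★★ The centred (160)-shape bound feeds the socket's per-bond near hypothesis on `π(□)` with `M_Δ := M` -/

/-- ★★★ **PRINT's (160), CENTRED AT ANY POINT OF THE WINDOW, GIVES THE SOCKET's NEAR HYPOTHESIS WITH `M_Δ := M`.**  Let `D` be a nested family of height `k` (`k ≤ m + K`),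
`□ = box L a M k` a window box (`1 ≤ M`) with a chosen centre `x_c ∈ □`, and `B` a datum on the cells of `D` with values in any seminormed group.  If at every TOP-level cell
`‖B c‖ ≤ β·(dist_k(c₋, Bᵏ(π x_c)) + 1)` (`0 ≤ β`; print's «(8d²L² + 4L²|x − y|)ε₁» after the triangle inequality, `β = C·ε₁`), then for every bond `b` based in `π(□)` and
every top-level cell: `‖B c‖ ≤ β·M·(distBI D b c + 1)` — the hypothesis `hBnear` of `letters10On_HB_of_core_adm22_T4` ∕ `letters10On_HB_cubeDomains_box` with `C_d·ε₁ := β`,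
`M_Δ := M`. [cite: Balaban1985Variational, (160)–(161) p.303 («M_Δ = M for Δ = □»), (164) p.304] -/
theorem near_of_centred_box {E : Type*} [SeminormedAddCommGroup E] (D : Domains P) {a : Pt P.d} {M : ℕ} (hk : D.k ≤ P.m + P.K) (hM : 1 ≤ M)
    {xc : Pt P.d} (hxc : xc ∈ box P.L a M D.k) {B : BondIdx D → E} {β : ℝ} (hβ : 0 ≤ β)
    (hX : ∀ c : BondIdx D, (c.1.1 : ℕ) = D.k → ‖B c‖ ≤ β * (distSite (Mk P (c.1.1 : ℕ)) c.1.2.src (iterBlockOf (c.1.1 : ℕ) (cover P xc)) + 1)) :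
    ∀ b : PBond P 0, b.src ∈ cover P '' box P.L a M D.k → ∀ c : BondIdx D, (c.1.1 : ℕ) = D.k → ‖B c‖ ≤ β * M * (distBI D b c + 1) := by
  intro b hb c hc
  obtain ⟨x, hx, hbx⟩ := hb
  have hr : distSite (Mk P D.k) (iterBlockOf D.k b.src) (iterBlockOf D.k (cover P xc)) ≤ ((M - 1 : ℕ) : ℝ) := by
    rw [← hbx]
    exact distSite_iterBlockOf_cover_le_of_mem_box hk hM hx hxc
  have hd := dist_le_distBI_add_top D c hc hr
  have hd0 : 0 ≤ distBI D b c := by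
    unfold distBI
    exact mul_nonneg (pow_nonneg (inv_nonneg.2 (Nat.cast_nonneg _)) _) (distSite_nonneg _ _)
  have hM1 : ((M - 1 : ℕ) : ℝ) = (M : ℝ) - 1 := by
    rw [Nat.cast_sub hM, Nat.cast_one]
  have hMr : (1 : ℝ) ≤ M := by exact_mod_cast hM
  calc ‖B c‖ ≤ β * (distSite (Mk P (c.1.1 : ℕ)) c.1.2.src (iterBlockOf (c.1.1 : ℕ) (cover P xc)) + 1) := hX c hc
    _ ≤ β * (distBI D b c + M) := by
        refine mul_le_mul_of_nonneg_left ?_ hβ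
        rw [hM1] at hd; linarith
    _ ≤ β * M * (distBI D b c + 1) := by
        rw [mul_assoc]
        refine mul_le_mul_of_nonneg_left ?_ hβ
        nlinarith

end Summit.QuantumFields.YangMills.BalabanUVNodes.N07NearDataOfCentre

end
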